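import Mathlib.Analysis.InnerProductSpace.PiL2
import Mathlib.Algebra.Order.Archimedean.Basic
import Literature.MathematicalPhysics.QuantumFieldTheory.Balaban1983to89.B4Eq19LatticeOperators
import HarnessLib

/-!
# Crux `HistoryTailL` (stmt-QuantumFields-19936), K2 organ lane — «FLAT ORGAN LETTERS»: the trivial corner, monotonicity, heredity and the
# HALVING NORMAL FORM of the displayed organ `hImproveCoreFlat` (v0/v1 bac8eda3, LEAD ★w1-19936 g9; consumed by ✓K-5 `hImproveCore_of_flat`)

Cell `ym3-torus` (YM ladder rung R3 = continuum SU(2) Yang–Mills on T³ — a RUNG, NOT the Clay problem: not d = 4, not infinite volume, not a mass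
gap); TWIN-WIDTH helper seat `ym-ust-19936-w7` g13.  Helper `--supports stmt-QuantumFields-19936`; THEOREMS ONLY (0 `def`, 0 `sorry`, default
heartbeats).  The organ `hImproveCoreFlat` («a unit `ℝ⁴`-valued lattice map on `ℤ³` that almost minimises the flat Dirichlet energy in every
sub-box `Q_{ρ+1}(z′) ⊆ Q_R(z)` with slack `δ·(ρ+1)` and has bounded normalised energy `E(Q_R(z)) ≤ Λ₀R` has normalised energy `≤ ε₁` at ONE
comparable scale `r ∈ [R∕C₀, R∕4]`») is written out VERBATIM as the shape `⟨organ at (Λ₀, ε₁)⟩ := ∃ (δ C₀ R₀ : ℝ), …` below; the organ text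
itself is `∀ (Λ₀ ε₁ : ℝ), 0 < Λ₀ → 0 < ε₁ → ⟨organ at (Λ₀, ε₁)⟩`.

WHAT IS PROVED (ns `…Theorems.PoincareLipschitzFlatOrganLetters`; pure bookkeeping, no regularity theory).
* §1 `energy_box_mono` (the flat energy of a box is monotone in the radius), `flat_rows_of_subbox` (HEREDITY: the almost-minimality row of
  `Q_R(z)` is inherited by every sub-box `Q_{R″}(z″) ⊆ Q_R(z)` with the same slack), `flat_rows_mono_slack` (a smaller slack implies the row).
* §2 ★ `flat_trivial_of_le` — THE TRIVIAL CORNER: `⟨organ at (Λ₀, ε₁)⟩` holds outright whenever `8Λ₀ ≤ ε₁` (`δ := 1, C₀ := 8, R₀ := 8`,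
  `r := R ∕ 4`: `E(Q_{2r}) ≤ E(Q_R) ≤ Λ₀R ≤ 8Λ₀r ≤ ε₁r`) — so a supplier only ever works at `Λ₀ > ε₁∕8` (K-3 calls the organ at `Λ₀ = 7272`).
* §3 `flat_mono` (monotone: `Λ₀ ↓`, `ε₁ ↑`), ★ `flat_compose` (`⟨organ at (Λ₀, ε)⟩ ∧ ⟨organ at (ε∕2, ε₁)⟩ ⟹ ⟨organ at (Λ₀, ε₁)⟩` with
  `δ := min`, `C₀ := C₀·C₀′`, `R₀ := max R₀ (C₀R₀′)` — the good scale `2r` of the first is the top scale of the second, by heredity).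
* §4 ★★ `flat_of_halving` — THE HALVING NORMAL FORM: `(∀ Λ, 0 < Λ → ⟨organ at (Λ, Λ)⟩) ⟹ ⟨hImproveCoreFlat⟩` (finite iteration along `Λ₀∕2ⁱ`
  down to the trivial corner, `⌈log₂(8Λ₀∕ε₁)⌉` steps), and the converse `halving_of_flat`; i.e. the organ is EQUIVALENT to «halve the
  normalised flat energy at one comparable scale»: `E(Q_R) ≤ ΛR ⟹ ∃ r ∈ [R∕C₀, R∕4], E(Q_{2r}) ≤ Λr`.
HONEST SCOPE.  Letters about a displayed hypothesis; NOTHING here proves `hImproveCoreFlat` ∕ `hImproveCore` ∕ `hImprove` (SU84-class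
bounded-energy regularity of lattice minimisers into `S³`, not in print), K1-exp, `MeanDeviationL`, `BlockLipschitzL` or `HistoryTailL`.
YM₃ on T³ is rung R3, not Clay; YM gap NOT proved; no summit statement is proved here.

References: R. Schoen, K. Uhlenbeck, J. Diff. Geom. 17 (1982) 307–335 [SchoenUhlenbeck1982] (§2, the scale-invariant energy `r^{2−n}E(B_r)`);
M. Giaquinta, Multiple integrals in the calculus of variations (1983) [Giaquinta1984] (Ch. III §1 p.64, boxes).
-/

set_option autoImplicit false

noncomputable section

open scoped BigOperators InnerProductSpace
open Finset

namespace Summit.QuantumFields.YangMills.Theorems.PoincareLipschitzFlatOrganLetters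

open Literature.MathematicalPhysics.QuantumFieldTheory.Balaban1983to89
open B4Eq19LatticeOperators (Zd box unitVec mem_box box_mono self_mem_box)

/-! ## §1 Energy monotonicity in the radius; heredity of the almost-minimality row -/

/-- The flat energy `E(u; Q_r(z)) = Σ_{y ∈ Q_r(z)} Σ_μ ‖u(y+e_μ) − u y‖²` is monotone in the radius. [folklore]
[cite: Giaquinta1984, Ch. III §1 p.64] -/
theorem energy_box_mono (u : Zd 3 → EuclideanSpace ℝ (Fin 4)) (z : Zd 3) {r r' : ℤ} (h : r ≤ r') :
    ∑ y ∈ box z r, ∑ μ : Fin 3, ‖u (y + unitVec μ) - u y‖ ^ 2 ≤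
      ∑ y ∈ box z r', ∑ μ : Fin 3, ‖u (y + unitVec μ) - u y‖ ^ 2 :=
  Finset.sum_le_sum_of_subset_of_nonneg (box_mono z h) fun _ _ _ => by positivity

/-- HEREDITY of the almost-minimality row: if `u` almost minimises the flat energy (slack `δ·(ρ+1)`) in every sub-box of `Q_R(z)`, it does
so in every sub-box of any `Q_{R″}(z″) ⊆ Q_R(z)`. [folklore] [cite: SchoenUhlenbeck1982, §2] -/
theorem flat_rows_of_subbox {u : Zd 3 → EuclideanSpace ℝ (Fin 4)} {z z'' : Zd 3} {R R'' : ℤ} {δ : ℝ}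
    (hmin : ∀ (z' : Zd 3) (ρ : ℤ), 0 ≤ ρ → box z' (ρ + 1) ⊆ box z R →
      ∀ v : Zd 3 → EuclideanSpace ℝ (Fin 4), (∀ y, y ∉ box z' ρ → v y = u y) → (∀ y ∈ box z' ρ, ‖v y‖ = 1) →
        ∑ y ∈ box z' (ρ + 1), ∑ μ : Fin 3, ‖u (y + unitVec μ) - u y‖ ^ 2 ≤
          (∑ y ∈ box z' (ρ + 1), ∑ μ : Fin 3, ‖v (y + unitVec μ) - v y‖ ^ 2) + δ * ((ρ : ℝ) + 1))
    (hsub : box z'' R'' ⊆ box z R) :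
    ∀ (z' : Zd 3) (ρ : ℤ), 0 ≤ ρ → box z' (ρ + 1) ⊆ box z'' R'' →
      ∀ v : Zd 3 → EuclideanSpace ℝ (Fin 4), (∀ y, y ∉ box z' ρ → v y = u y) → (∀ y ∈ box z' ρ, ‖v y‖ = 1) →
        ∑ y ∈ box z' (ρ + 1), ∑ μ : Fin 3, ‖u (y + unitVec μ) - u y‖ ^ 2 ≤
          (∑ y ∈ box z' (ρ + 1), ∑ μ : Fin 3, ‖v (y + unitVec μ) - v y‖ ^ 2) + δ * ((ρ : ℝ) + 1) :=
  fun z' ρ hρ h => hmin z' ρ hρ (h.trans hsub)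

/-- The almost-minimality row is monotone in the slack: slack `δ ≤ δ′` row implies the `δ′` row. [folklore] [cite: SchoenUhlenbeck1982, §2] -/
theorem flat_rows_mono_slack {u : Zd 3 → EuclideanSpace ℝ (Fin 4)} {z : Zd 3} {R : ℤ} {δ δ' : ℝ} (hδ : δ ≤ δ')
    (hmin : ∀ (z' : Zd 3) (ρ : ℤ), 0 ≤ ρ → box z' (ρ + 1) ⊆ box z R →
      ∀ v : Zd 3 → EuclideanSpace ℝ (Fin 4), (∀ y, y ∉ box z' ρ → v y = u y) → (∀ y ∈ box z' ρ, ‖v y‖ = 1) →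
        ∑ y ∈ box z' (ρ + 1), ∑ μ : Fin 3, ‖u (y + unitVec μ) - u y‖ ^ 2 ≤
          (∑ y ∈ box z' (ρ + 1), ∑ μ : Fin 3, ‖v (y + unitVec μ) - v y‖ ^ 2) + δ * ((ρ : ℝ) + 1)) :
    ∀ (z' : Zd 3) (ρ : ℤ), 0 ≤ ρ → box z' (ρ + 1) ⊆ box z R →
      ∀ v : Zd 3 → EuclideanSpace ℝ (Fin 4), (∀ y, y ∉ box z' ρ → v y = u y) → (∀ y ∈ box z' ρ, ‖v y‖ = 1) →
        ∑ y ∈ box z' (ρ + 1), ∑ μ : Fin 3, ‖u (y + unitVec μ) - u y‖ ^ 2 ≤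
          (∑ y ∈ box z' (ρ + 1), ∑ μ : Fin 3, ‖v (y + unitVec μ) - v y‖ ^ 2) + δ' * ((ρ : ℝ) + 1) := by
  intro z' ρ hρ hsub v hv hv1
  have hρ1 : (0 : ℝ) ≤ (ρ : ℝ) + 1 := by
    have : (0 : ℝ) ≤ (ρ : ℝ) := by exact_mod_cast hρ
    linarith
  exact (hmin z' ρ hρ hsub v hv hv1).trans (by nlinarith [mul_le_mul_of_nonneg_right hδ hρ1])

/-! ## §2 The trivial corner `8Λ₀ ≤ ε₁` -/

/-- ★ THE TRIVIAL CORNER of the organ `hImproveCoreFlat`: at every `(Λ₀, ε₁)` with `8Λ₀ ≤ ε₁` the organ's conclusion holds outright with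
`δ := 1, C₀ := 8, R₀ := 8` and `r := R ∕ 4` (`E(Q_{2r}) ≤ E(Q_R) ≤ Λ₀R ≤ 8Λ₀r ≤ ε₁r`); neither the unit constraint nor the almost-minimality
row is used.  (So the organ's content is the regime `Λ₀ > ε₁∕8`; ✓K-3 calls it at `Λ₀ = 7272`.) [folklore] [cite: SchoenUhlenbeck1982, §2] -/
theorem flat_trivial_of_le (Λ₀ ε₁ : ℝ) (hΛ₀ : 0 < Λ₀) (h8 : 8 * Λ₀ ≤ ε₁) :
    ∃ (δ C₀ R₀ : ℝ), 0 < δ ∧ 1 ≤ C₀ ∧ 1 ≤ R₀ ∧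
      ∀ (u : Zd 3 → EuclideanSpace ℝ (Fin 4)) (z : Zd 3) (R : ℤ),
        R₀ ≤ R →
        (∀ y, ‖u y‖ = 1) →
        (∀ (z' : Zd 3) (ρ : ℤ), 0 ≤ ρ → box z' (ρ + 1) ⊆ box z R →
          ∀ v : Zd 3 → EuclideanSpace ℝ (Fin 4), (∀ y, y ∉ box z' ρ → v y = u y) → (∀ y ∈ box z' ρ, ‖v y‖ = 1) →
            ∑ y ∈ box z' (ρ + 1), ∑ μ : Fin 3, ‖u (y + unitVec μ) - u y‖ ^ 2 ≤
              (∑ y ∈ box z' (ρ + 1), ∑ μ : Fin 3, ‖v (y + unitVec μ) - v y‖ ^ 2) + δ * ((ρ : ℝ) + 1)) →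
        (∑ y ∈ box z R, ∑ μ : Fin 3, ‖u (y + unitVec μ) - u y‖ ^ 2 ≤ Λ₀ * R) →
        ∃ r : ℤ, 1 ≤ r ∧ (R : ℝ) ≤ C₀ * r ∧ 4 * r ≤ R ∧
          ∑ y ∈ box z (2 * r), ∑ μ : Fin 3, ‖u (y + unitVec μ) - u y‖ ^ 2 ≤ ε₁ * r := by
  refine ⟨1, 8, 8, one_pos, by norm_num, by norm_num, ?_⟩
  intro u z R hR _hu _hmin hE
  have hR8 : (8 : ℤ) ≤ R := by exact_mod_cast hR
  obtain ⟨r, hr⟩ : ∃ r : ℤ, r = R / 4 := ⟨_, rfl⟩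
  have hr1 : 1 ≤ r := by omega
  have hr4 : 4 * r ≤ R := by omega
  have hr8 : R ≤ 8 * r := by omega
  have hr8' : (R : ℝ) ≤ 8 * (r : ℝ) := by exact_mod_cast hr8
  have hr0 : (0 : ℝ) ≤ (r : ℝ) := by exact_mod_cast (by omega : (0 : ℤ) ≤ r)
  refine ⟨r, hr1, hr8', hr4, ?_⟩
  calc ∑ y ∈ box z (2 * r), ∑ μ : Fin 3, ‖u (y + unitVec μ) - u y‖ ^ 2
      ≤ ∑ y ∈ box z R, ∑ μ : Fin 3, ‖u (y + unitVec μ) - u y‖ ^ 2 := energy_box_mono u z (by omega)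
    _ ≤ Λ₀ * R := hE
    _ ≤ Λ₀ * (8 * r) := mul_le_mul_of_nonneg_left hr8' hΛ₀.le
    _ = (8 * Λ₀) * r := by ring
    _ ≤ ε₁ * r := mul_le_mul_of_nonneg_right h8 hr0

/-! ## §3 Monotonicity in `(Λ₀, ε₁)` and composition of two organ instances -/

/-- The organ's conclusion at `(Λ₀, ε₁)` is monotone: it implies the conclusion at every `(Λ₀′, ε₁′)` with `Λ₀′ ≤ Λ₀`, `ε₁ ≤ ε₁′`
(same `δ, C₀, R₀`). [folklore] [cite: SchoenUhlenbeck1982, §2] -/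
theorem flat_mono {Λ₀ ε₁ Λ₀' ε₁' : ℝ} (hΛ : Λ₀' ≤ Λ₀) (hε : ε₁ ≤ ε₁')
    (h : ∃ (δ C₀ R₀ : ℝ), 0 < δ ∧ 1 ≤ C₀ ∧ 1 ≤ R₀ ∧
      ∀ (u : Zd 3 → EuclideanSpace ℝ (Fin 4)) (z : Zd 3) (R : ℤ),
        R₀ ≤ R →
        (∀ y, ‖u y‖ = 1) →
        (∀ (z' : Zd 3) (ρ : ℤ), 0 ≤ ρ → box z' (ρ + 1) ⊆ box z R →
          ∀ v : Zd 3 → EuclideanSpace ℝ (Fin 4), (∀ y, y ∉ box z' ρ → v y = u y) → (∀ y ∈ box z' ρ, ‖v y‖ = 1) →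
            ∑ y ∈ box z' (ρ + 1), ∑ μ : Fin 3, ‖u (y + unitVec μ) - u y‖ ^ 2 ≤
              (∑ y ∈ box z' (ρ + 1), ∑ μ : Fin 3, ‖v (y + unitVec μ) - v y‖ ^ 2) + δ * ((ρ : ℝ) + 1)) →
        (∑ y ∈ box z R, ∑ μ : Fin 3, ‖u (y + unitVec μ) - u y‖ ^ 2 ≤ Λ₀ * R) →
        ∃ r : ℤ, 1 ≤ r ∧ (R : ℝ) ≤ C₀ * r ∧ 4 * r ≤ R ∧
          ∑ y ∈ box z (2 * r), ∑ μ : Fin 3, ‖u (y + unitVec μ) - u y‖ ^ 2 ≤ ε₁ * r) :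
    ∃ (δ C₀ R₀ : ℝ), 0 < δ ∧ 1 ≤ C₀ ∧ 1 ≤ R₀ ∧
      ∀ (u : Zd 3 → EuclideanSpace ℝ (Fin 4)) (z : Zd 3) (R : ℤ),
        R₀ ≤ R →
        (∀ y, ‖u y‖ = 1) →
        (∀ (z' : Zd 3) (ρ : ℤ), 0 ≤ ρ → box z' (ρ + 1) ⊆ box z R →
          ∀ v : Zd 3 → EuclideanSpace ℝ (Fin 4), (∀ y, y ∉ box z' ρ → v y = u y) → (∀ y ∈ box z' ρ, ‖v y‖ = 1) →
            ∑ y ∈ box z' (ρ + 1), ∑ μ : Fin 3, ‖u (y + unitVec μ) - u y‖ ^ 2 ≤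
              (∑ y ∈ box z' (ρ + 1), ∑ μ : Fin 3, ‖v (y + unitVec μ) - v y‖ ^ 2) + δ * ((ρ : ℝ) + 1)) →
        (∑ y ∈ box z R, ∑ μ : Fin 3, ‖u (y + unitVec μ) - u y‖ ^ 2 ≤ Λ₀' * R) →
        ∃ r : ℤ, 1 ≤ r ∧ (R : ℝ) ≤ C₀ * r ∧ 4 * r ≤ R ∧
          ∑ y ∈ box z (2 * r), ∑ μ : Fin 3, ‖u (y + unitVec μ) - u y‖ ^ 2 ≤ ε₁' * r := by
  obtain ⟨δ, C₀, R₀, hδ, hC₀, hR₀, H⟩ := h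
  refine ⟨δ, C₀, R₀, hδ, hC₀, hR₀, fun u z R hR hu hmin hE => ?_⟩
  have hR0 : (0 : ℝ) ≤ (R : ℝ) := by linarith
  obtain ⟨r, hr1, hrC, hr4, hrE⟩ := H u z R hR hu hmin (hE.trans (mul_le_mul_of_nonneg_right hΛ hR0))
  have hr0 : (0 : ℝ) ≤ (r : ℝ) := by exact_mod_cast (by omega : (0 : ℤ) ≤ r)
  exact ⟨r, hr1, hrC, hr4, hrE.trans (mul_le_mul_of_nonneg_right hε hr0)⟩

/-- ★ COMPOSITION of two organ instances: the conclusion at `(Λ₀, ε)` and the conclusion at `(ε∕2, ε₁)` give the conclusion at `(Λ₀, ε₁)`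
with `δ := min δ δ′`, `C₀ := C₀·C₀′`, `R₀ := max R₀ (C₀·R₀′)`: the good scale `2r` of the first instance (`E(Q_{2r}) ≤ εr = (ε∕2)·2r`) is the
top scale of the second, whose hypotheses hold there by heredity (`flat_rows_of_subbox`, `Q_{2r}(z) ⊆ Q_R(z)`) and slack monotonicity.
[folklore] [cite: SchoenUhlenbeck1982, §2] -/
theorem flat_compose {Λ₀ ε ε₁ : ℝ}
    (h₁ : ∃ (δ C₀ R₀ : ℝ), 0 < δ ∧ 1 ≤ C₀ ∧ 1 ≤ R₀ ∧
      ∀ (u : Zd 3 → EuclideanSpace ℝ (Fin 4)) (z : Zd 3) (R : ℤ),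
        R₀ ≤ R →
        (∀ y, ‖u y‖ = 1) →
        (∀ (z' : Zd 3) (ρ : ℤ), 0 ≤ ρ → box z' (ρ + 1) ⊆ box z R →
          ∀ v : Zd 3 → EuclideanSpace ℝ (Fin 4), (∀ y, y ∉ box z' ρ → v y = u y) → (∀ y ∈ box z' ρ, ‖v y‖ = 1) →
            ∑ y ∈ box z' (ρ + 1), ∑ μ : Fin 3, ‖u (y + unitVec μ) - u y‖ ^ 2 ≤
              (∑ y ∈ box z' (ρ + 1), ∑ μ : Fin 3, ‖v (y + unitVec μ) - v y‖ ^ 2) + δ * ((ρ : ℝ) + 1)) →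
        (∑ y ∈ box z R, ∑ μ : Fin 3, ‖u (y + unitVec μ) - u y‖ ^ 2 ≤ Λ₀ * R) →
        ∃ r : ℤ, 1 ≤ r ∧ (R : ℝ) ≤ C₀ * r ∧ 4 * r ≤ R ∧
          ∑ y ∈ box z (2 * r), ∑ μ : Fin 3, ‖u (y + unitVec μ) - u y‖ ^ 2 ≤ ε * r)
    (h₂ : ∃ (δ C₀ R₀ : ℝ), 0 < δ ∧ 1 ≤ C₀ ∧ 1 ≤ R₀ ∧
      ∀ (u : Zd 3 → EuclideanSpace ℝ (Fin 4)) (z : Zd 3) (R : ℤ),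
        R₀ ≤ R →
        (∀ y, ‖u y‖ = 1) →
        (∀ (z' : Zd 3) (ρ : ℤ), 0 ≤ ρ → box z' (ρ + 1) ⊆ box z R →
          ∀ v : Zd 3 → EuclideanSpace ℝ (Fin 4), (∀ y, y ∉ box z' ρ → v y = u y) → (∀ y ∈ box z' ρ, ‖v y‖ = 1) →
            ∑ y ∈ box z' (ρ + 1), ∑ μ : Fin 3, ‖u (y + unitVec μ) - u y‖ ^ 2 ≤
              (∑ y ∈ box z' (ρ + 1), ∑ μ : Fin 3, ‖v (y + unitVec μ) - v y‖ ^ 2) + δ * ((ρ : ℝ) + 1)) →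
        (∑ y ∈ box z R, ∑ μ : Fin 3, ‖u (y + unitVec μ) - u y‖ ^ 2 ≤ ε / 2 * R) →
        ∃ r : ℤ, 1 ≤ r ∧ (R : ℝ) ≤ C₀ * r ∧ 4 * r ≤ R ∧
          ∑ y ∈ box z (2 * r), ∑ μ : Fin 3, ‖u (y + unitVec μ) - u y‖ ^ 2 ≤ ε₁ * r) :
    ∃ (δ C₀ R₀ : ℝ), 0 < δ ∧ 1 ≤ C₀ ∧ 1 ≤ R₀ ∧
      ∀ (u : Zd 3 → EuclideanSpace ℝ (Fin 4)) (z : Zd 3) (R : ℤ),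
        R₀ ≤ R →
        (∀ y, ‖u y‖ = 1) →
        (∀ (z' : Zd 3) (ρ : ℤ), 0 ≤ ρ → box z' (ρ + 1) ⊆ box z R →
          ∀ v : Zd 3 → EuclideanSpace ℝ (Fin 4), (∀ y, y ∉ box z' ρ → v y = u y) → (∀ y ∈ box z' ρ, ‖v y‖ = 1) →
            ∑ y ∈ box z' (ρ + 1), ∑ μ : Fin 3, ‖u (y + unitVec μ) - u y‖ ^ 2 ≤
              (∑ y ∈ box z' (ρ + 1), ∑ μ : Fin 3, ‖v (y + unitVec μ) - v y‖ ^ 2) + δ * ((ρ : ℝ) + 1)) →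
        (∑ y ∈ box z R, ∑ μ : Fin 3, ‖u (y + unitVec μ) - u y‖ ^ 2 ≤ Λ₀ * R) →
        ∃ r : ℤ, 1 ≤ r ∧ (R : ℝ) ≤ C₀ * r ∧ 4 * r ≤ R ∧
          ∑ y ∈ box z (2 * r), ∑ μ : Fin 3, ‖u (y + unitVec μ) - u y‖ ^ 2 ≤ ε₁ * r := by
  obtain ⟨δ₁, C₁, R₁, hδ₁, hC₁, hR₁, H₁⟩ := h₁
  obtain ⟨δ₂, C₂, R₂, hδ₂, hC₂, hR₂, H₂⟩ := h₂
  refine ⟨min δ₁ δ₂, C₁ * C₂, max R₁ (C₁ * R₂), lt_min hδ₁ hδ₂, one_le_mul_of_one_le_of_one_le hC₁ hC₂,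
    le_max_of_le_left hR₁, fun u z R hR hu hmin hE => ?_⟩
  have hRR₁ : R₁ ≤ R := (le_max_left _ _).trans hR
  have hRR₂ : C₁ * R₂ ≤ R := (le_max_right _ _).trans hR
  -- first instance at the top scale `R` (slack `min δ₁ δ₂ ≤ δ₁`)
  obtain ⟨r, hr1, hrC, hr4, hrE⟩ := H₁ u z R hRR₁ hu (flat_rows_mono_slack (min_le_left δ₁ δ₂) hmin) hE
  have hr0 : (0 : ℝ) ≤ (r : ℝ) := by exact_mod_cast (by omega : (0 : ℤ) ≤ r)
  have h2rR : 2 * r ≤ R := by omega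
  -- second instance at the good scale `2r`
  have hR₂' : R₂ ≤ ((2 * r : ℤ) : ℝ) := by
    have hC₁0 : (0 : ℝ) < C₁ := by linarith
    have h1 : C₁ * R₂ ≤ C₁ * r := hRR₂.trans hrC
    have h2 : R₂ ≤ r := le_of_mul_le_mul_left h1 hC₁0
    push_cast; linarith
  have hE₂ : ∑ y ∈ box z (2 * r), ∑ μ : Fin 3, ‖u (y + unitVec μ) - u y‖ ^ 2 ≤ ε / 2 * ((2 * r : ℤ) : ℝ) := by
    have : ε / 2 * ((2 * r : ℤ) : ℝ) = ε * r := by push_cast; ring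
    rw [this]; exact hrE
  obtain ⟨r', hr'1, hr'C, hr'4, hr'E⟩ := H₂ u z (2 * r) hR₂' hu
    (flat_rows_mono_slack (min_le_right δ₁ δ₂) (flat_rows_of_subbox hmin (box_mono z h2rR))) hE₂
  refine ⟨r', hr'1, ?_, by omega, hr'E⟩
  have hr'0 : (0 : ℝ) ≤ (r' : ℝ) := by exact_mod_cast (by omega : (0 : ℤ) ≤ r')
  have h2r : ((2 * r : ℤ) : ℝ) = 2 * (r : ℝ) := by push_cast; ring
  rw [h2r] at hr'C
  have hrr' : (r : ℝ) ≤ C₂ * r' := by nlinarith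
  calc (R : ℝ) ≤ C₁ * r := hrC
    _ ≤ C₁ * (C₂ * r') := mul_le_mul_of_nonneg_left hrr' (by linarith)
    _ = C₁ * C₂ * r' := by ring

/-! ## §4 The halving normal form -/

/-- Iteration engine for `flat_of_halving`: from the HALVING organ `∀ Λ > 0, ⟨organ at (Λ, Λ)⟩` and the trivial corner, the organ's
conclusion at `(Λ₀, ε₁)` for every `0 < Λ₀ ≤ 2ⁿ·ε₁∕8`, by induction on `n` (`flat_compose` at `ε := Λ₀`, induction hypothesis at `Λ₀∕2`).
[folklore] [cite: SchoenUhlenbeck1982, §2] -/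
theorem flat_of_halving_aux
    (H : ∀ Λ : ℝ, 0 < Λ → ∃ (δ C₀ R₀ : ℝ), 0 < δ ∧ 1 ≤ C₀ ∧ 1 ≤ R₀ ∧
      ∀ (u : Zd 3 → EuclideanSpace ℝ (Fin 4)) (z : Zd 3) (R : ℤ),
        R₀ ≤ R →
        (∀ y, ‖u y‖ = 1) →
        (∀ (z' : Zd 3) (ρ : ℤ), 0 ≤ ρ → box z' (ρ + 1) ⊆ box z R →
          ∀ v : Zd 3 → EuclideanSpace ℝ (Fin 4), (∀ y, y ∉ box z' ρ → v y = u y) → (∀ y ∈ box z' ρ, ‖v y‖ = 1) →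
            ∑ y ∈ box z' (ρ + 1), ∑ μ : Fin 3, ‖u (y + unitVec μ) - u y‖ ^ 2 ≤
              (∑ y ∈ box z' (ρ + 1), ∑ μ : Fin 3, ‖v (y + unitVec μ) - v y‖ ^ 2) + δ * ((ρ : ℝ) + 1)) →
        (∑ y ∈ box z R, ∑ μ : Fin 3, ‖u (y + unitVec μ) - u y‖ ^ 2 ≤ Λ * R) →
        ∃ r : ℤ, 1 ≤ r ∧ (R : ℝ) ≤ C₀ * r ∧ 4 * r ≤ R ∧
          ∑ y ∈ box z (2 * r), ∑ μ : Fin 3, ‖u (y + unitVec μ) - u y‖ ^ 2 ≤ Λ * r)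
    (ε₁ : ℝ) (n : ℕ) :
    ∀ Λ₀ : ℝ, 0 < Λ₀ → Λ₀ ≤ 2 ^ n * (ε₁ / 8) →
    ∃ (δ C₀ R₀ : ℝ), 0 < δ ∧ 1 ≤ C₀ ∧ 1 ≤ R₀ ∧
      ∀ (u : Zd 3 → EuclideanSpace ℝ (Fin 4)) (z : Zd 3) (R : ℤ),
        R₀ ≤ R →
        (∀ y, ‖u y‖ = 1) →
        (∀ (z' : Zd 3) (ρ : ℤ), 0 ≤ ρ → box z' (ρ + 1) ⊆ box z R →
          ∀ v : Zd 3 → EuclideanSpace ℝ (Fin 4), (∀ y, y ∉ box z' ρ → v y = u y) → (∀ y ∈ box z' ρ, ‖v y‖ = 1) →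
            ∑ y ∈ box z' (ρ + 1), ∑ μ : Fin 3, ‖u (y + unitVec μ) - u y‖ ^ 2 ≤
              (∑ y ∈ box z' (ρ + 1), ∑ μ : Fin 3, ‖v (y + unitVec μ) - v y‖ ^ 2) + δ * ((ρ : ℝ) + 1)) →
        (∑ y ∈ box z R, ∑ μ : Fin 3, ‖u (y + unitVec μ) - u y‖ ^ 2 ≤ Λ₀ * R) →
        ∃ r : ℤ, 1 ≤ r ∧ (R : ℝ) ≤ C₀ * r ∧ 4 * r ≤ R ∧
          ∑ y ∈ box z (2 * r), ∑ μ : Fin 3, ‖u (y + unitVec μ) - u y‖ ^ 2 ≤ ε₁ * r := by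
  induction n with
  | zero =>
    intro Λ₀ hΛ₀ hle
    exact flat_trivial_of_le Λ₀ ε₁ hΛ₀ (by rw [pow_zero, one_mul] at hle; linarith)
  | succ n ih =>
    intro Λ₀ hΛ₀ hle
    have hhalf : Λ₀ / 2 ≤ 2 ^ n * (ε₁ / 8) := by rw [pow_succ] at hle; linarith
    have h₂ := ih (Λ₀ / 2) (by positivity) hhalf
    exact flat_compose (H Λ₀ hΛ₀) h₂

/-- ★★ THE HALVING NORMAL FORM of the organ: if for every `Λ > 0` unit maps with the almost-minimality row and `E(Q_R(z)) ≤ ΛR` have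
`E(Q_{2r}(z)) ≤ Λr` at one comparable scale `r ∈ [R∕C₀(Λ), R∕4]` (normalised energy HALVED: `E(Q_{2r})∕(2r) ≤ Λ∕2`), then `hImproveCoreFlat`
(v1 = v0 bac8eda3, VERBATIM) holds — `⌈log₂(8Λ₀∕ε₁)⌉` halvings reach the trivial corner `flat_trivial_of_le`. [folklore] [cite: SchoenUhlenbeck1982, §2] -/
theorem flat_of_halving
    (H : ∀ Λ : ℝ, 0 < Λ → ∃ (δ C₀ R₀ : ℝ), 0 < δ ∧ 1 ≤ C₀ ∧ 1 ≤ R₀ ∧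
      ∀ (u : Zd 3 → EuclideanSpace ℝ (Fin 4)) (z : Zd 3) (R : ℤ),
        R₀ ≤ R →
        (∀ y, ‖u y‖ = 1) →
        (∀ (z' : Zd 3) (ρ : ℤ), 0 ≤ ρ → box z' (ρ + 1) ⊆ box z R →
          ∀ v : Zd 3 → EuclideanSpace ℝ (Fin 4), (∀ y, y ∉ box z' ρ → v y = u y) → (∀ y ∈ box z' ρ, ‖v y‖ = 1) →
            ∑ y ∈ box z' (ρ + 1), ∑ μ : Fin 3, ‖u (y + unitVec μ) - u y‖ ^ 2 ≤
              (∑ y ∈ box z' (ρ + 1), ∑ μ : Fin 3, ‖v (y + unitVec μ) - v y‖ ^ 2) + δ * ((ρ : ℝ) + 1)) →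
        (∑ y ∈ box z R, ∑ μ : Fin 3, ‖u (y + unitVec μ) - u y‖ ^ 2 ≤ Λ * R) →
        ∃ r : ℤ, 1 ≤ r ∧ (R : ℝ) ≤ C₀ * r ∧ 4 * r ≤ R ∧
          ∑ y ∈ box z (2 * r), ∑ μ : Fin 3, ‖u (y + unitVec μ) - u y‖ ^ 2 ≤ Λ * r) :
    ∀ (Λ₀ ε₁ : ℝ), 0 < Λ₀ → 0 < ε₁ →
    ∃ (δ C₀ R₀ : ℝ), 0 < δ ∧ 1 ≤ C₀ ∧ 1 ≤ R₀ ∧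
      ∀ (u : Zd 3 → EuclideanSpace ℝ (Fin 4)) (z : Zd 3) (R : ℤ),
        R₀ ≤ R →
        (∀ y, ‖u y‖ = 1) →
        (∀ (z' : Zd 3) (ρ : ℤ), 0 ≤ ρ → box z' (ρ + 1) ⊆ box z R →
          ∀ v : Zd 3 → EuclideanSpace ℝ (Fin 4), (∀ y, y ∉ box z' ρ → v y = u y) → (∀ y ∈ box z' ρ, ‖v y‖ = 1) →
            ∑ y ∈ box z' (ρ + 1), ∑ μ : Fin 3, ‖u (y + unitVec μ) - u y‖ ^ 2 ≤
              (∑ y ∈ box z' (ρ + 1), ∑ μ : Fin 3, ‖v (y + unitVec μ) - v y‖ ^ 2) + δ * ((ρ : ℝ) + 1)) →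
        (∑ y ∈ box z R, ∑ μ : Fin 3, ‖u (y + unitVec μ) - u y‖ ^ 2 ≤ Λ₀ * R) →
        ∃ r : ℤ, 1 ≤ r ∧ (R : ℝ) ≤ C₀ * r ∧ 4 * r ≤ R ∧
          ∑ y ∈ box z (2 * r), ∑ μ : Fin 3, ‖u (y + unitVec μ) - u y‖ ^ 2 ≤ ε₁ * r := by
  intro Λ₀ ε₁ hΛ₀ hε₁
  obtain ⟨n, hn⟩ := pow_unbounded_of_one_lt (Λ₀ / (ε₁ / 8)) (by norm_num : (1 : ℝ) < 2)
  have hle : Λ₀ ≤ 2 ^ n * (ε₁ / 8) := by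
    have h8 : (0 : ℝ) < ε₁ / 8 := by positivity
    rw [div_lt_iff₀ h8] at hn
    exact hn.le
  exact flat_of_halving_aux H ε₁ n Λ₀ hΛ₀ hle

/-- The converse of `flat_of_halving` (trivial instance `ε₁ := Λ`): `hImproveCoreFlat` (VERBATIM) implies the halving organ; together the two
are EQUIVALENT displays of the K2 organ's flat form. [folklore] [cite: SchoenUhlenbeck1982, §2] -/
theorem halving_of_flat
    (hF : ∀ (Λ₀ ε₁ : ℝ), 0 < Λ₀ → 0 < ε₁ →
      ∃ (δ C₀ R₀ : ℝ), 0 < δ ∧ 1 ≤ C₀ ∧ 1 ≤ R₀ ∧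
      ∀ (u : Zd 3 → EuclideanSpace ℝ (Fin 4)) (z : Zd 3) (R : ℤ),
        R₀ ≤ R →
        (∀ y, ‖u y‖ = 1) →
        (∀ (z' : Zd 3) (ρ : ℤ), 0 ≤ ρ → box z' (ρ + 1) ⊆ box z R →
          ∀ v : Zd 3 → EuclideanSpace ℝ (Fin 4), (∀ y, y ∉ box z' ρ → v y = u y) → (∀ y ∈ box z' ρ, ‖v y‖ = 1) →
            ∑ y ∈ box z' (ρ + 1), ∑ μ : Fin 3, ‖u (y + unitVec μ) - u y‖ ^ 2 ≤
              (∑ y ∈ box z' (ρ + 1), ∑ μ : Fin 3, ‖v (y + unitVec μ) - v y‖ ^ 2) + δ * ((ρ : ℝ) + 1)) →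
        (∑ y ∈ box z R, ∑ μ : Fin 3, ‖u (y + unitVec μ) - u y‖ ^ 2 ≤ Λ₀ * R) →
        ∃ r : ℤ, 1 ≤ r ∧ (R : ℝ) ≤ C₀ * r ∧ 4 * r ≤ R ∧
          ∑ y ∈ box z (2 * r), ∑ μ : Fin 3, ‖u (y + unitVec μ) - u y‖ ^ 2 ≤ ε₁ * r) :
    ∀ Λ : ℝ, 0 < Λ → ∃ (δ C₀ R₀ : ℝ), 0 < δ ∧ 1 ≤ C₀ ∧ 1 ≤ R₀ ∧
      ∀ (u : Zd 3 → EuclideanSpace ℝ (Fin 4)) (z : Zd 3) (R : ℤ),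
        R₀ ≤ R →
        (∀ y, ‖u y‖ = 1) →
        (∀ (z' : Zd 3) (ρ : ℤ), 0 ≤ ρ → box z' (ρ + 1) ⊆ box z R →
          ∀ v : Zd 3 → EuclideanSpace ℝ (Fin 4), (∀ y, y ∉ box z' ρ → v y = u y) → (∀ y ∈ box z' ρ, ‖v y‖ = 1) →
            ∑ y ∈ box z' (ρ + 1), ∑ μ : Fin 3, ‖u (y + unitVec μ) - u y‖ ^ 2 ≤
              (∑ y ∈ box z' (ρ + 1), ∑ μ : Fin 3, ‖v (y + unitVec μ) - v y‖ ^ 2) + δ * ((ρ : ℝ) + 1)) →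
        (∑ y ∈ box z R, ∑ μ : Fin 3, ‖u (y + unitVec μ) - u y‖ ^ 2 ≤ Λ * R) →
        ∃ r : ℤ, 1 ≤ r ∧ (R : ℝ) ≤ C₀ * r ∧ 4 * r ≤ R ∧
          ∑ y ∈ box z (2 * r), ∑ μ : Fin 3, ‖u (y + unitVec μ) - u y‖ ^ 2 ≤ Λ * r :=
  fun Λ hΛ => hF Λ Λ hΛ hΛ

end Summit.QuantumFields.YangMills.Theorems.PoincareLipschitzFlatOrganLetters

end
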